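import Summits.Ventures.PercRepro.RankLevelSetUpPairDeletion
import Summits.Ventures.PercRepro.RankLevelSetUpNullityFive

/-! # RankLevelSetUpPairNullityFive — THE PAIR (↑) AT LEVEL `5` ON EVERY MATROID OF NULLITY `≤ 5` MODULO THE PAIR
(↑)₅ ON NULLITY `≤ 4` AND THE PAIR COLOOP RESIDUE (P₂), AND UNCONDITIONALLY ON LINE-SPARSE DUALS (night-1 g40;
dossier §52.15; on `RankLevelSetUpPairDeletion` and `RankLevelSetUpNullityFive`)

Strong induction on `#E` inside a class `P` closed under the contraction of an element: a loop kills the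
through-`{b,c}` family; nullity `≤ 4` is the hypothesis `h4`; nullity `5` is the pair deletion-averaging step
`upPairAt_five_of_contract_of_residue` with the inductive hypothesis on the contractions `M ／ x` (`x ∉ {b, c}`;
the exact middle when `#E = 12`) and the residue (P₂). Hence **`upPairAt_five_of_nullity_five_of_residues`**
(`P = True`) and **`upPairAt_five_of_lineSparse`** (`P = LineSparse M✶`: nullity `≤ 4` by `upPairAt_of_bound_two`
with `bound_two_of_lineSparse`, the residue by `upPairFiveDeletionResidue_of_lineSparse` — UNCONDITIONAL). Every
declaration has a docstring; imports: the cell's own modules and Mathlib only. Axioms: standard. -/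

namespace PercRepro

open Set Matroid

variable {α : Type}

/-- **THE PAIR (↑) AT LEVEL `5` ON A CONTRACTION-CLOSED CLASS OF MATROIDS OF NULLITY `≤ 5`, FROM THE PAIR (↑)₅ ON
ITS MEMBERS OF NULLITY `≤ 4` AND THE RESIDUE (P₂) ON ITS LOOPLESS MEMBERS OF NULLITY `5`**: strong induction on
`#E`. -/
theorem upPairAt_five_of_class_of_residues (P : Matroid α → Prop)
    (hPc : ∀ (M : Matroid α) (x : α), P M → P (M.contract {x}))
    (h4 : ∀ (M : Matroid α) [M.Finite], P M → M✶.eRank ≤ 4 → 12 ≤ M.E.ncard →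
      ∀ b ∈ M.E, ∀ c ∈ M.E, b ≠ c → BiIndepUpPairAt M b c 5)
    (hres : ∀ (M : Matroid α) [M.Finite], P M → (∀ e, ¬ M.IsLoop e) → M✶.eRank = 5 → 12 ≤ M.E.ncard →
      ∀ b ∈ M.E, ∀ c ∈ M.E, b ≠ c → UpPairFiveDeletionResidue M b c) :
    ∀ n : ℕ, ∀ (M : Matroid α) [M.Finite], P M → M.E.ncard = n → M✶.eRank ≤ 5 → 12 ≤ n →
      ∀ b ∈ M.E, ∀ c ∈ M.E, b ≠ c → BiIndepUpPairAt M b c 5 := by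
  intro n
  induction n using Nat.strong_induction_on with
  | _ n ih =>
    intro M _ hPM hn hν h12 b hb c hc hbc
    by_cases hloop : ∃ ℓ, M.IsLoop ℓ
    · obtain ⟨ℓ, hℓ⟩ := hloop
      unfold BiIndepUpPairAt
      have : {W ∈ biIndep M 5 | b ∈ W ∧ c ∈ W} = ∅ := by
        rw [biIndep_eq_empty_of_isLoop M hℓ 5]
        ext W; simp
      rw [this, Set.ncard_empty]
      exact Nat.zero_le _
    simp only [not_exists] at hloop
    by_cases hν4 : M✶.eRank ≤ 4
    · exact h4 M hPM hν4 (by omega) b hb c hc hbc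
    have h5 : M✶.eRank = 5 := eRank_dual_eq_five_of_not_le_four M hν hν4
    refine upPairAt_five_of_contract_of_residue M hloop hb hc hbc (by omega) ?_
      (hres M hPM hloop h5 (by omega) b hb c hc hbc)
    intro x hx
    haveI : (M.contract {x}).Finite := inferInstance
    have hcard : (M.contract {x}).E.ncard = n - 1 := by
      rw [ncard_ground_contract_singleton M hx.1, hn]
    have hν' : (M.contract {x})✶.eRank ≤ 5 := (eRank_dual_contract_le M {x}).trans hν
    have hxb : x ≠ b := fun h => hx.2 (by rw [h]; exact Set.mem_insert b {c})
    have hxc : x ≠ c := fun h => hx.2 (by rw [h]; exact Set.mem_insert_of_mem b rfl)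
    have hbM : b ∈ (M.contract {x}).E := by
      rw [Matroid.contract_ground]
      exact ⟨hb, fun h => hxb (by rw [Set.mem_singleton_iff] at h; exact h.symm)⟩
    have hcM : c ∈ (M.contract {x}).E := by
      rw [Matroid.contract_ground]
      exact ⟨hc, fun h => hxc (by rw [Set.mem_singleton_iff] at h; exact h.symm)⟩
    rcases Nat.lt_or_ge 12 n with hlt | hge
    · exact ih (n - 1) (by omega) (M.contract {x}) (hPc M x hPM) hcard hν' (by omega) b hbM c hcM hbc
    · -- the exact middle `#E − 1 = 11`: the pair (↑)₅ is the complementation identity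
      rw [upPairAt_iff_through_le_through _ hbM hcM (by rw [hcard]; omega), hcard]
      have e : n - 1 - 1 - 5 = 5 := by omega
      rw [e]

/-- **THE PAIR (↑) AT LEVEL `5` ON EVERY MATROID OF NULLITY `≤ 5` WITH `≥ 12` ELEMENTS, AT EVERY PAIR, MODULO THE
PAIR (↑)₅ ON NULLITY `≤ 4` AND THE RESIDUE (P₂) ON THE LOOPLESS MATROIDS OF NULLITY `5`.** -/
theorem upPairAt_five_of_nullity_five_of_residues
    (h4 : ∀ (M : Matroid α) [M.Finite], M✶.eRank ≤ 4 → 12 ≤ M.E.ncard →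
      ∀ b ∈ M.E, ∀ c ∈ M.E, b ≠ c → BiIndepUpPairAt M b c 5)
    (hres : ∀ (M : Matroid α) [M.Finite], (∀ e, ¬ M.IsLoop e) → M✶.eRank = 5 → 12 ≤ M.E.ncard →
      ∀ b ∈ M.E, ∀ c ∈ M.E, b ≠ c → UpPairFiveDeletionResidue M b c)
    (M : Matroid α) [M.Finite] (hν : M✶.eRank ≤ 5) (hn : 12 ≤ M.E.ncard) {b c : α} (hb : b ∈ M.E)
    (hc : c ∈ M.E) (hbc : b ≠ c) : BiIndepUpPairAt M b c 5 :=
  upPairAt_five_of_class_of_residues (fun _ => True) (fun _ _ _ => trivial)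
    (fun M' _ _ hν4 h12 b' hb' c' hc' hbc' => h4 M' hν4 h12 b' hb' c' hc' hbc')
    (fun M' _ _ hl h5 h12 b' hb' c' hc' hbc' => hres M' hl h5 h12 b' hb' c' hc' hbc')
    M.E.ncard M trivial rfl hν hn b hb c hc hbc

/-- **THE PAIR (↑) AT LEVEL `5` ON EVERY MATROID OF NULLITY `≤ 5` WITH `≥ 12` ELEMENTS WHOSE DUAL IS LINE-SPARSE,
AT EVERY PAIR — UNCONDITIONALLY**: on nullity `≤ 4` the chain with the coloop bound `2` of a line-sparse dual
(every complement of the chain has `≥ 7` elements), on nullity `5` the residue `upPairFiveDeletionResidue_of_lineSparse`. -/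
theorem upPairAt_five_of_lineSparse (M : Matroid α) [M.Finite] (hν : M✶.eRank ≤ 5) (hls : LineSparse M✶)
    (hn : 12 ≤ M.E.ncard) {b c : α} (hb : b ∈ M.E) (hc : c ∈ M.E) (hbc : b ≠ c) : BiIndepUpPairAt M b c 5 :=
  upPairAt_five_of_class_of_residues (fun M' => LineSparse M'✶) (fun M' x h => lineSparse_contract M' {x} h)
    (fun M' _ hls' hν4 h12 b' hb' c' hc' hbc' =>
      upPairAt_of_bound_two M' hb' hc' hbc' (by norm_num) h12
        (fun j _ hj W hW _ _ => bound_two_of_lineSparse M' (hν4.trans (by norm_num)) hls' hW (by omega)))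
    (fun M' _ hls' _ h5 h12 b' _ c' _ _ => upPairFiveDeletionResidue_of_lineSparse M' (le_of_eq h5) hls' h12 b' c')
    M.E.ncard M hls rfl hν hn b hb c hc hbc

end PercRepro
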